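import Summits.BirchSwinnertonDyer.Rank1Residual.F1Sign2.KummerField
import Mathlib.LinearAlgebra.Matrix.Charpoly.Minpoly
import Mathlib.LinearAlgebra.Charpoly.ToMatrix
import Mathlib.RingTheory.Norm.Basic
import HarnessLib

/-!
# DESC-§22-HK (module E) — the Kummer map over an arbitrary field of characteristic 0: homomorphism, rank certificate,
congruence criterion, norm condition; instances at `ℚ₂` and `ℝ`; typed candidate B2 «the local image at 2 is one bit»

Continuation of module D = `F1Sign2/KummerField.lean` (the landing name of `KummerFieldD.lean`).  Source of truth /
check evidence: `HOME/MEMO-desc-data/g14/lean/KummerField-concat.lean` (D + E in one file, rc 0 / 0 warnings / 0 sorries,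
standard axioms).

TYPER FILING (cell `bsd-f1-sign2`, seat `-ty` g9; CANDIDATES.md rows DESC-§22-HK₂ `KummerHalvingCriterionAtQTwo`, HK∞ `KummerHalvingCriterionAtReal`, HK₂″ `KummerMapHomomorphismAtQTwo` (support, PROVED) + typed candidate DESC-§22-B2 `LocalImageOneBitAtTwo` / B2K `LocalKummerImageOneBitAtTwo` (plain `def … : Prop`, OPEN in the tree, KNOWN in print = a theorem of Stoll 2001, hence no `@[conjecture]`
tag; nothing asserted) with the PROVED equivalence `localImageOneBitAtTwo_iff`; -desc g14 ADDENDUM 9 + P.S.2, 2026-08-28T10:49:59Z/11:01:39Z): `HOME/MEMO-desc-data/g14/lean/KummerFieldE.lean` ac1721257e6dcad0 VERBATIM from `noncomputable section` to `end`; typer edits = this paragraph, the REF1/REF2 sentences (REF1 r4 on B2), `[cite: …]` tags, one-line docstrings on twelve helpers (tree lint);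
statements and proofs byte-identical. Builder `tools/mk_kfield.py E` (`HOME/MEMO-ty-data/g9/`).
REF1-AUDIT §94 (g9, 2026-08-28T10:59:52Z): B2 `LocalImageOneBitAtTwo` / B2K SURVIVE as typed, OPEN-in-tree / in print, CLEARED to file (ProbeB2 41730fdb696be1fa rc 0, axioms trio); modules D/E CLEARED statement+proof-only; hypotheses audit: `Irreducible (cubicK W)` load-bearing in B2 (eB2: the cusp `y² = x³` over `ℚ₂` is fully 2-divisible — the binders carry no `IsElliptic`, irreducibility does that job).
REF2-PLACEMENT v25 §7 (0fe067e0b1982f3b, 2026-08-28T10:54:27Z): HK₂/HK₂″ KNOWN (Cassels 1991 §15 Lemmas 1–2 are field-generic; Silverman AEC X.1.1/X.1.4); B2 KNOWN IN PRINT / open in tree = Stoll 2001 Lemma 4.4 (1) «K a p-adic local field, d_K = [K:ℚ₂] if p = 2: dim J(K)/2J(K) = dim J(K)[2] + d_K·g» (proof → Schaefer 1998 Prop. 2.4 / Milne ADT Lemma I.3.3), at g = 1, K = ℚ₂; formalisation target (formal-group filtration of `E(ℚ₂)`); beyond-print theorem: no; PARTITION: none.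
BC5 / FALSIFIER (-desc MEMO-desc §22.13-add4 UPDATE 7; kit j304550, PARTIAL shards, place rows `p = 2` of the 2 232 glued pairs): engine local-image dimension `dim W(ℚ₂)/2W(ℚ₂) = 1 + dim_𝔽₂ W(ℚ₂)[2]` on 2 232/2 232 rows — `(#roots_ℚ₂(c_E), dim)` = (0,1) ×969, (1,2) ×1179, (3,3) ×84, identical for the partner; the 969 rows with `c_E` irreducible over `ℚ₂` are B2's instances (a non-square class
found, no third class), 0 exceptions. WHY (NOT) NOVEL (-desc): nothing — a textbook statement, typed so that «the sign at 2 is one parity bit» has a Lean meaning over kernel-checked local Kummer theory; open in the tree for want of the formal-group filtration of `E(ℚ₂)`. PARTITION: none; beyond-print theorem: no. BSD is not proved here.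
-/

noncomputable section

open scoped Classical

open WeierstrassCurve Polynomial

namespace Summit.BirchSwinnertonDyer.Rank1Residual.F1Sign2.KummerField

variable {K : Type*} [Field K] [CharZero K]

/-! ## The Kummer map is a homomorphism modulo squares

For `P ∈ W(K)` put `κ(P) := 4x_P − θ ∈ L = K[T]/(c_W)` (`κ(0) := 1`).  CHORD IDENTITY: for affine `P, Q` with
`x_P ≠ x_Q`, `κ(P) κ(Q) κ(P+Q) = (2λ(θ − 4x_P) + 8y_P)²` with `λ` the chord slope (the line `y = λ(x − x_P) + y_P`
meets the cubic in `P, Q, −(P+Q)`; evaluate `g(x) − (λ(x−x_P)+y_P)² = (x−x_P)(x−x_Q)(x−x_{P+Q})` at `x = θ/4`).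
Together with the tangent case (`isSquare_of_halves`) and the trivial cases this gives, uniformly in `P, Q`:
`κ(P) κ(Q) κ(P+Q) ∈ L^{×2} ∪ {0}·…` — precisely `IsSquare (κ P * κ Q * κ (P+Q))` — i.e. `κ : W(K) → L^×/L^{×2}` is a
group homomorphism, and by Cassels' lemma its kernel is exactly `2W(ℚ)`. -/

omit [CharZero K] in
/-- CHORD IDENTITY: `(4x₁ − θ)(4x₂ − θ)(4x₃ − θ)` is a square in `L`, where `x₃ = x(P + Q)`, `x₁ ≠ x₂`. -/
theorem isSquare_kummer_chord (W : WeierstrassCurve K) (h1 : W.a₁ = 0) (h3 : W.a₃ = 0) {x₁ y₁ x₂ y₂ : K}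
    (hx : x₁ ≠ x₂) (hP : W.toAffine.Equation x₁ y₁) (hQ : W.toAffine.Equation x₂ y₂) :
    IsSquare ((algebraMap K (algK W) (4 * x₁) - rootK W) *
      (algebraMap K (algK W) (4 * x₂) - rootK W) *
      (algebraMap K (algK W) (4 * W.toAffine.addX x₁ x₂ (W.toAffine.slope x₁ x₂ y₁ y₂)) - rootK W)) := by
  rw [WeierstrassCurve.Affine.slope_of_X_ne hx]
  have heP := equation_of_a₁_a₃ W h1 h3 hP
  have heQ := equation_of_a₁_a₃ W h1 h3 hQ
  have hF := root_relation_of_a₁_a₃ W h1 h3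
  have hx' : (x₁ - x₂) ≠ 0 := sub_ne_zero.mpr hx
  have hI0 := congrArg (algebraMap K (algK W)) (mul_inv_cancel₀ hx')
  have hL0 : (y₁ - y₂) / (x₁ - x₂) * (x₁ - x₂) = y₁ - y₂ := div_mul_cancel₀ _ hx'
  have hL := congrArg (algebraMap K (algK W)) hL0
  have heP' := congrArg (algebraMap K (algK W)) heP
  have heQ' := congrArg (algebraMap K (algK W)) heQ
  simp only [WeierstrassCurve.Affine.addX, h1, zero_mul, add_zero, map_mul, map_sub, map_add, map_pow, map_one,
    map_ofNat] at hI0 hL heP' heQ' ⊢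
  refine ⟨2 * algebraMap K (algK W) ((y₁ - y₂) / (x₁ - x₂)) *
      (rootK W - 4 * algebraMap K (algK W) x₁) + 8 * algebraMap K (algK W) y₁, ?_⟩
  generalize rootK W = t at hF ⊢
  generalize algebraMap K (algK W) ((y₁ - y₂) / (x₁ - x₂)) = Lam at hL ⊢
  generalize algebraMap K (algK W) (x₁ - x₂)⁻¹ = I at hI0 ⊢
  generalize algebraMap K (algK W) x₁ = X1 at heP' hL hI0 ⊢
  generalize algebraMap K (algK W) x₂ = X2 at heQ' hL hI0 ⊢
  generalize algebraMap K (algK W) y₁ = Y1 at heP' hL ⊢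
  generalize algebraMap K (algK W) y₂ = Y2 at heQ' hL ⊢
  generalize algebraMap K (algK W) W.a₂ = A2 at hF heP' heQ' ⊢
  generalize algebraMap K (algK W) W.a₄ = A4 at hF heP' heQ' ⊢
  generalize algebraMap K (algK W) W.a₆ = A6 at hF heP' heQ' ⊢
  linear_combination (-1) * hF +
    (-((4 * X1 - t) * (4 * X2 - t) * (4 * (Lam ^ 2 - A2 - X1 - X2) - t) - (2 * Lam * (t - 4 * X1) + 8 * Y1) ^ 2 +
      (t ^ 3 + 4 * A2 * t ^ 2 + 16 * A4 * t + 64 * A6))) * hI0 +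
    (16 * I * (4 * X2 - t)) * heP' + (16 * I * (t - 4 * X1)) * heQ' +
    (-(16 * I * (t - 4 * X1) * (Y2 + Lam * (X2 - X1) + Y1))) * hL

/-- The Kummer element of a rational point: `κ(0) = 1`, `κ((x, y)) = 4x − θ`. -/
def kummerElt (W : WeierstrassCurve K) : W.toAffine.Point → algK W
  | .zero => 1
  | .some x _ _ => algebraMap K (algK W) (4 * x) - rootK W

omit [CharZero K] in
/-- `κ(0) = 1`. -/
@[simp] lemma kummerElt_zero (W : WeierstrassCurve K) : kummerElt W 0 = 1 := rfl

omit [CharZero K] in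
/-- `κ((x, y)) = 4x − θ`. -/
@[simp] lemma kummerElt_some (W : WeierstrassCurve K) {x y : K} (h : W.toAffine.Nonsingular x y) :
    kummerElt W (WeierstrassCurve.Affine.Point.some x y h) = algebraMap K (algK W) (4 * x) - rootK W := rfl

omit [CharZero K] in
/-- `κ(−P) = κ(P)`. -/
lemma kummerElt_neg (W : WeierstrassCurve K) (P : W.toAffine.Point) : kummerElt W (-P) = kummerElt W P := by
  rcases P with _ | ⟨x, y, h⟩
  · rfl
  · rfl

/-- **THE KUMMER MAP IS A HOMOMORPHISM MODULO SQUARES** (uniform in `P, Q`, all cases: `0`, opposite, tangent, chord):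
`κ(P) · κ(Q) · κ(P + Q)` is a square in `L = K[T]/(c_W)`. -/
theorem isSquare_kummerElt_mul_mul_add (W : WeierstrassCurve K) (h1 : W.a₁ = 0) (h3 : W.a₃ = 0)
    (P Q : W.toAffine.Point) : IsSquare (kummerElt W P * kummerElt W Q * kummerElt W (P + Q)) := by
  rcases P with _ | ⟨x₁, y₁, hP⟩
  · simp only [← WeierstrassCurve.Affine.Point.zero_def, kummerElt_zero, one_mul, zero_add]
    exact ⟨kummerElt W Q, rfl⟩
  rcases Q with _ | ⟨x₂, y₂, hQ⟩
  · simp only [← WeierstrassCurve.Affine.Point.zero_def, kummerElt_zero, mul_one, add_zero]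
    exact ⟨kummerElt W (WeierstrassCurve.Affine.Point.some x₁ y₁ hP), rfl⟩
  by_cases hx : x₁ = x₂
  · subst hx
    by_cases hy : y₁ = W.toAffine.negY x₁ y₂
    · rw [WeierstrassCurve.Affine.Point.add_of_Y_eq rfl hy]
      simp only [kummerElt_zero, kummerElt_some, mul_one]
      exact ⟨algebraMap K (algK W) (4 * x₁) - rootK W, rfl⟩
    · -- tangent case: `y₂ = y₁` (same `x`, `y₁ ≠ −y₂`), so `Q = P` and `κ(P)² κ(2P)` is a square by the halving lemma.
      have hy21 : y₂ = y₁ := by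
        have e1 := equation_of_a₁_a₃ W h1 h3 hP.1
        have e2 := equation_of_a₁_a₃ W h1 h3 hQ.1
        rw [negY_of_a₁_a₃ W h1 h3] at hy
        have hsq : (y₂ - y₁) * (y₂ + y₁) = 0 := by linear_combination e2 - e1
        rcases mul_eq_zero.mp hsq with h0 | h0
        · linear_combination h0
        · exact absurd (by linear_combination h0 : y₁ = -y₂) hy
      subst hy21
      rcases hR : WeierstrassCurve.Affine.Point.some x₁ y₂ hP + WeierstrassCurve.Affine.Point.some x₁ y₂ hQ with _ | ⟨x₃, y₃, h₃⟩
      · simp only [← WeierstrassCurve.Affine.Point.zero_def, kummerElt_zero, kummerElt_some, mul_one]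
        exact ⟨algebraMap K (algK W) (4 * x₁) - rootK W, rfl⟩
      · obtain ⟨r, hr⟩ := isSquare_of_halves W h1 h3 h₃ (WeierstrassCurve.Affine.Point.some x₁ y₂ hP) hR
        simp only [kummerElt_some]
        exact ⟨(algebraMap K (algK W) (4 * x₁) - rootK W) * r, by rw [hr]; ring⟩
  · rw [WeierstrassCurve.Affine.Point.add_of_X_ne hx]
    simp only [kummerElt_some]
    exact isSquare_kummer_chord W h1 h3 hx hP.1 hQ.1

/-- Point-level CASSELS' LEMMA (uniform, `0` included): `P ∈ 2W(K) ⟺ κ(P) ∈ L²`. -/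
theorem halves_iff_isSquare_kummerElt (W : WeierstrassCurve K) (h1 : W.a₁ = 0) (h3 : W.a₃ = 0) (P : W.toAffine.Point) :
    (∃ Q : W.toAffine.Point, Q + Q = P) ↔ IsSquare (kummerElt W P) := by
  rcases P with _ | ⟨x, y, h⟩
  · simp only [← WeierstrassCurve.Affine.Point.zero_def, kummerElt_zero]
    exact ⟨fun _ => ⟨1, (mul_one 1).symm⟩, fun _ => ⟨0, add_zero 0⟩⟩
  · simp only [kummerElt_some]
    exact halves_iff_isSquare W h1 h3 h

/-- DESC-§22-H″ (support, KNOWN in print: the Kummer / Cassels `x − θ` map is a homomorphism `W(ℚ) → L^×/L^{×2}`):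
for every `W : y² = x³ + a₂x² + a₄x + a₆` over `ℚ` and all `P, Q ∈ W(ℚ)`, `κ(P) κ(Q) κ(P+Q) ∈ L²`
(`κ(0) = 1`, `κ(x,y) = 4x − θ_W`).  With H′ (`KummerHalvingCriterion`, point-level form `halves_iff_isSquare_kummerElt`):
`ker κ = 2W(K)`, i.e. `κ̄ : W(K)/2W(K) ↪ L^×/L^{×2}` — the 2-descent (Kummer) embedding, kernel-certified for every such `W`. -/
def KummerMapHomomorphismOver (K : Type*) [Field K] [CharZero K] : Prop :=
  ∀ (W : WeierstrassCurve K), W.a₁ = 0 → W.a₃ = 0 → ∀ (P Q : W.toAffine.Point),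
    IsSquare (kummerElt W P * kummerElt W Q * kummerElt W (P + Q))

/-- Row DESC-§22-HK″ holds over every field of characteristic `0`. -/
theorem kummerMapHomomorphismOver_holds : KummerMapHomomorphismOver K :=
  fun W h1 h3 P Q => isSquare_kummerElt_mul_mul_add W h1 h3 P Q

/-! ## Rank certificate: a non-square Kummer value forces infinite order

If the 2-division cubic `c_W` is irreducible over `ℚ` then `W(ℚ)[2] = 0`, every torsion point has odd order and hence
lies in `2W(K)`, so its Kummer value is a square (H′).  Contrapositive: **`κ(P) ∉ L² ⇒ P has infinite order`** — a
rank-`≥ 1` certificate from ONE non-square value, for every `y² = x³ + a₂x² + a₄x + a₆` (row V′ is its instance at the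
marked point of the glued partner). -/

/-- No rational point with `y = 0` when `c_W` is irreducible (`a₁ = a₃ = 0`). -/
lemma not_equation_zero_of_irreducible (W : WeierstrassCurve K) (h1 : W.a₁ = 0) (h3 : W.a₃ = 0)
    (hirr : Irreducible (cubicK W)) {x : K} (h : W.toAffine.Equation x 0) : False := by
  have heq := equation_of_a₁_a₃ W h1 h3 h
  have hroot : IsRoot (cubicK W) (4 * x) := by
    simp only [IsRoot, cubicK, eval_add, eval_mul, eval_pow, eval_X, eval_C, b₂_of_a₁ W h1,
      b₄_of_a₁_a₃ W h1 h3, b₆_of_a₃ W h3]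
    linear_combination (-64) * heq
  have hd1 := degree_eq_one_of_irreducible_of_root hirr hroot
  have hd3 : (cubicK W).degree = 3 := by
    unfold cubicK; compute_degree!
  rw [hd3] at hd1
  exact absurd hd1 (by decide)

/-- `W(K)[2] = 0` when `c_W` is irreducible. -/
lemma eq_zero_of_two_nsmul_eq_zero_of_irreducible (W : WeierstrassCurve K) (h1 : W.a₁ = 0) (h3 : W.a₃ = 0)
    (hirr : Irreducible (cubicK W)) (S : W.toAffine.Point) (h2 : S + S = 0) : S = 0 := by
  rcases S with _ | ⟨x, y, hS⟩
  · rfl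
  · by_cases hy : y = W.toAffine.negY x y
    · have hy0 : y = 0 := by
        rw [negY_of_a₁_a₃ W h1 h3] at hy
        exact (mul_eq_zero.mp (show (2 : K) * y = 0 by linear_combination hy)).resolve_left two_ne_zero
      subst hy0
      exact (not_equation_zero_of_irreducible W h1 h3 hirr hS.1).elim
    · rw [WeierstrassCurve.Affine.Point.add_self_of_Y_ne hy] at h2
      exact absurd h2 (WeierstrassCurve.Affine.Point.some_ne_zero _)

/-- With `c_W` irreducible, `2ⁿ • P = 0 ⇒ P = 0` (no `K`-rational 2-power torsion). -/
lemma eq_zero_of_two_pow_nsmul_eq_zero_of_irreducible (W : WeierstrassCurve K) (h1 : W.a₁ = 0) (h3 : W.a₃ = 0)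
    (hirr : Irreducible (cubicK W)) (k : ℕ) : ∀ S : W.toAffine.Point, (2 ^ k) • S = 0 → S = 0 := by
  induction k with
  | zero => intro S h; simpa using h
  | succ k ih =>
      intro S h
      have h' : (2 ^ k) • (S + S) = 0 := by
        rw [← two_nsmul, ← mul_nsmul, ← pow_succ']; exact h
      exact eq_zero_of_two_nsmul_eq_zero_of_irreducible W h1 h3 hirr S (ih _ h')

/-- Torsion points are divisible by `2` when `c_W` is irreducible (their order is odd). -/
theorem exists_halves_of_isOfFinAddOrder (W : WeierstrassCurve K) (h1 : W.a₁ = 0) (h3 : W.a₃ = 0)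
    (hirr : Irreducible (cubicK W)) (P : W.toAffine.Point) (hfin : IsOfFinAddOrder P) :
    ∃ Q : W.toAffine.Point, Q + Q = P := by
  obtain ⟨n, hn, hnP⟩ := (isOfFinAddOrder_iff_nsmul_eq_zero).mp hfin
  obtain ⟨k, m, hm, rfl⟩ := Nat.exists_eq_two_pow_mul_odd hn.ne'
  have e1 : (2 ^ k) • (m • P) = 0 := by
    rw [← mul_nsmul, Nat.mul_comm]; exact hnP
  have e2 : m • P = 0 := eq_zero_of_two_pow_nsmul_eq_zero_of_irreducible W h1 h3 hirr k _ e1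
  obtain ⟨j, rfl⟩ := hm
  refine ⟨-(j • P), ?_⟩
  have e3 : (2 * j) • P + P = 0 := by rw [← succ_nsmul]; exact e2
  rw [mul_nsmul', two_nsmul] at e3
  rw [← neg_add]
  exact (eq_neg_of_add_eq_zero_right e3).symm

/-- **RANK CERTIFICATE**: `c_W` irreducible and `κ(P) ∉ L²` ⇒ `P` has infinite order (so `rank W(K) ≥ 1`). -/
theorem not_isOfFinAddOrder_of_not_isSquare_kummerElt (W : WeierstrassCurve K) (h1 : W.a₁ = 0) (h3 : W.a₃ = 0)
    (hirr : Irreducible (cubicK W)) (P : W.toAffine.Point) (hP : ¬ IsSquare (kummerElt W P)) :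
    ¬ IsOfFinAddOrder P :=
  fun hfin => hP ((halves_iff_isSquare_kummerElt W h1 h3 P).mp (exists_halves_of_isOfFinAddOrder W h1 h3 hirr P hfin))

/-- DESC-§22-H‴ (support): for every `W : y² = x³ + a₂x² + a₄x + a₆` over `ℚ` with irreducible 2-division cubic and every
`P ∈ W(K)`: `κ(P) = 4x_P − θ_W ∉ L^{2} ⇒ P` has infinite order.  (Row V′ = the instance `W = E′_f`, `P = (0,c)`, where
`κ(P) = −θ′` and `−θ′ ∈ L′² ⟺ u ∈ L²` by the glued-pair identity.) -/
def KummerRankCertificateOver (K : Type*) [Field K] [CharZero K] : Prop :=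
  ∀ (W : WeierstrassCurve K), W.a₁ = 0 → W.a₃ = 0 → Irreducible (cubicK W) →
    ∀ (P : W.toAffine.Point), ¬ IsSquare (kummerElt W P) → ¬ IsOfFinAddOrder P

/-- The rank certificate holds over every field of characteristic `0`. -/
theorem kummerRankCertificateOver_holds : KummerRankCertificateOver K :=
  fun W h1 h3 hirr P hP => not_isOfFinAddOrder_of_not_isSquare_kummerElt W h1 h3 hirr P hP

/-! ## Congruence criterion: `P ≡ Q (mod 2W(K)) ⟺ κ(P)κ(Q) ∈ L²` (irreducible cubic)

With `c_W` irreducible `L` is a field, `κ(P) ≠ 0`, and H′ + H″ combine to: `P + Q ∈ 2W(K) ⟺ κ(P)κ(Q)` is a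
square — i.e. `κ̄ : W(K)/2W(K) → L^×/L^{×2}` is an INJECTIVE HOMOMORPHISM, stated without quotients. -/

/-- `κ(P) ≠ 0` in `L_K`. -/
lemma kummerElt_ne_zero (W : WeierstrassCurve K) (P : W.toAffine.Point) : kummerElt W P ≠ 0 := by
  rcases P with _ | ⟨x, y, h⟩
  · intro h0
    change (1 : algK W) = 0 at h0
    have := coords_eq_zero W 1 0 0 (by simpa using h0)
    exact one_ne_zero this.1
  · intro h0
    have := coords_eq_zero W (4 * x) (-1) 0 (by
      simp only [kummerElt_some, map_mul, map_ofNat] at h0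
      simp only [map_mul, map_ofNat, map_neg, map_one, map_zero, zero_mul, add_zero]
      linear_combination h0)
    exact absurd this.2.1 (by norm_num)

/-- **CONGRUENCE CRITERION**: `c_W` irreducible ⇒ (`P + Q ∈ 2W(K) ⟺ κ(P)κ(Q) ∈ L²`). -/
theorem add_mem_two_iff_isSquare_mul (W : WeierstrassCurve K) (h1 : W.a₁ = 0) (h3 : W.a₃ = 0)
    (hirr : Irreducible (cubicK W)) (P Q : W.toAffine.Point) :
    (∃ R : W.toAffine.Point, R + R = P + Q) ↔ IsSquare (kummerElt W P * kummerElt W Q) := by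
  haveI : Fact (Irreducible (cubicK W)) := ⟨hirr⟩
  have hhom := isSquare_kummerElt_mul_mul_add W h1 h3 P Q
  have hPQ0 : kummerElt W P * kummerElt W Q ≠ 0 := mul_ne_zero (kummerElt_ne_zero W P) (kummerElt_ne_zero W Q)
  have hR0 : kummerElt W (P + Q) ≠ 0 := kummerElt_ne_zero W (P + Q)
  constructor
  · intro hR
    have hsqR : IsSquare (kummerElt W (P + Q)) := (halves_iff_isSquare_kummerElt W h1 h3 (P + Q)).mp hR
    have hdiv := hhom.div hsqR
    rwa [mul_div_cancel_right₀ _ hR0] at hdiv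
  · intro hsq
    have hdiv := hhom.div hsq
    rw [mul_comm (kummerElt W P * kummerElt W Q), mul_div_cancel_right₀ _ hPQ0] at hdiv
    exact (halves_iff_isSquare_kummerElt W h1 h3 (P + Q)).mpr hdiv

/-- DESC-§22-H⁗ (support): `κ̄ : W(K)/2W(K) ↪ L^×/L^{×2}` is an injective homomorphism, quotient-free form:
for every `W : y² = x³ + a₂x² + a₄x + a₆` over `ℚ` with irreducible 2-division cubic and all `P, Q ∈ W(ℚ)`,
`P + Q ∈ 2W(K) ⟺ κ(P)κ(Q) ∈ L²`. -/
def KummerCongruenceCriterionOver (K : Type*) [Field K] [CharZero K] : Prop :=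
  ∀ (W : WeierstrassCurve K), W.a₁ = 0 → W.a₃ = 0 → Irreducible (cubicK W) →
    ∀ (P Q : W.toAffine.Point), (∃ R : W.toAffine.Point, R + R = P + Q) ↔ IsSquare (kummerElt W P * kummerElt W Q)

/-- The congruence criterion holds over every field of characteristic `0`. -/
theorem kummerCongruenceCriterionOver_holds : KummerCongruenceCriterionOver K :=
  fun W h1 h3 hirr P Q => add_mem_two_iff_isSquare_mul W h1 h3 hirr P Q

/-! ## The norm condition over any field: `N_{L_K/K}(κ(P)) = c_W(4x_P) = 64 y_P²` -/

omit [CharZero K] in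
/-- `N_{L_K/K}(a − θ) = c_W(a)`. -/
theorem norm_algebraMap_sub_rootK (W : WeierstrassCurve K) (a : K) :
    Algebra.norm K (algebraMap K (algK W) a - rootK W) = (cubicK W).eval a := by
  let pb := AdjoinRoot.powerBasis (cubicK_monic W).ne_zero
  have hgen : pb.gen = rootK W := AdjoinRoot.powerBasis_gen _
  haveI : Module.Finite K (algK W) := pb.finite
  haveI : Module.Free K (algK W) := Module.Free.of_basis pb.basis
  have hlm : Algebra.lmul K (algK W) (algebraMap K (algK W) a) = algebraMap K (Module.End K (algK W)) a := by
    ext v; simp [Algebra.smul_def]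
  rw [Algebra.norm_apply, map_sub, hlm, ← LinearMap.eval_charpoly, ← LinearMap.charpoly_toMatrix _ pb.basis,
    ← Algebra.leftMulMatrix_apply, ← hgen, charpoly_leftMulMatrix, AdjoinRoot.minpoly_powerBasis_gen_of_monic (cubicK_monic W)]

omit [CharZero K] in
/-- `c_W(4x_P) = 64 y_P²` on the curve (`a₁ = a₃ = 0`). -/
lemma eval_cubicK_four_mul (W : WeierstrassCurve K) (h1 : W.a₁ = 0) (h3 : W.a₃ = 0) {x y : K} (h : W.toAffine.Equation x y) :
    (cubicK W).eval (4 * x) = 64 * y ^ 2 := by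
  have heq := equation_of_a₁_a₃ W h1 h3 h
  simp only [cubicK, eval_add, eval_mul, eval_pow, eval_X, eval_C, b₂_of_a₁ W h1, b₄_of_a₁_a₃ W h1 h3, b₆_of_a₃ W h3]
  linear_combination (-64) * heq

omit [CharZero K] in
/-- **NORM CONDITION** over any field: `N(κ(P))` is a square (`= 64y_P²`, resp. `1`). -/
theorem isSquare_norm_kummerElt (W : WeierstrassCurve K) (h1 : W.a₁ = 0) (h3 : W.a₃ = 0) (P : W.toAffine.Point) :
    IsSquare (Algebra.norm K (kummerElt W P)) := by
  rcases P with _ | ⟨x, y, hP⟩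
  · change IsSquare (Algebra.norm K (1 : algK W)); rw [map_one]; exact ⟨1, by ring⟩
  · rw [kummerElt_some, norm_algebraMap_sub_rootK, eval_cubicK_four_mul W h1 h3 hP.1]; exact ⟨8 * y, by ring⟩

/-- Over `ℚ` the generic cubic is the tree's `twoDivisionUCubic` (definitionally). -/
example (W : WeierstrassCurve ℚ) : cubicK W = twoDivisionUCubic W := rfl

/-- DESC-§22-HK₂ (support): the LOCAL halving criterion AT 2 — for every `W : y² = x³ + a₂x² + a₄x + a₆` over `ℚ₂` and every
`P = (x_P, y_P) ∈ W(ℚ₂)`: `P ∈ 2W(ℚ₂) ⟺ 4x_P − θ ∈ (ℚ₂[T]/(c_W))^{2}`.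
REF1 §94: CLEARED (PROVED).  REF2 v25 §7: KNOWN (Cassels 1991 §15 Lemma 2, field-generic; Silverman AEC X.1.1/X.1.4); formalisation;
beyond-print no.  [cite: Cassels1991, §15 Lemma 2] -/
def KummerHalvingCriterionAtQTwo : Prop := KummerHalvingCriterionOver ℚ_[2]

/-- Row DESC-§22-HK₂ holds. -/
theorem kummerHalvingCriterionAtQTwo_holds : KummerHalvingCriterionAtQTwo := kummerHalvingCriterionOver_holds

/-- DESC-§22-HK∞ (support): the halving criterion over `ℝ`. -/
def KummerHalvingCriterionAtReal : Prop := KummerHalvingCriterionOver ℝ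

/-- Row DESC-§22-HK∞ holds. -/
theorem kummerHalvingCriterionAtReal_holds : KummerHalvingCriterionAtReal := kummerHalvingCriterionOver_holds

/-- DESC-§22-HK₂″ (support): the local Kummer map AT 2 is a homomorphism modulo squares — for every `W : y² = x³ + a₂x² + a₄x + a₆`
over `ℚ₂` and `P, Q ∈ W(ℚ₂)`: `κ₂(P) κ₂(Q) κ₂(P+Q) ∈ (ℚ₂[T]/(c_W))^{2}`.  With HK₂: `W(ℚ₂)/2W(ℚ₂) → (ℚ₂[T]/(c_W))^×/□` is a
well-defined injective-on-`2W`-cosets homomorphism; its image is the local condition at 2 of the 2-Selmer group.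
REF1 §94: CLEARED (PROVED).  REF2 v25 §7: KNOWN (Cassels 1991 §15 Lemma 1, field-generic; Silverman AEC X.1.4); formalisation; beyond-print no.
[cite: Cassels1991, §15 Lemma 1] [cite: SilvermanAEC2009, Prop. X.1.4] -/
def KummerMapHomomorphismAtQTwo : Prop := KummerMapHomomorphismOver ℚ_[2]

/-- Row DESC-§22-HK₂″ holds. -/
theorem kummerMapHomomorphismAtQTwo_holds : KummerMapHomomorphismAtQTwo := kummerMapHomomorphismOver_holds

/-! ## Typed candidate (OPEN in tree, in print): the local image at 2 is ONE BIT -/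

/-- DESC-§22-B2 (typed candidate, OPEN in the tree; in print: `dim_𝔽₂ J(K)/2J(K) = dim_𝔽₂ J(K)[2] + [K:ℚ₂]·g` for a `2`-adic
field `K` — Stoll, Acta Arith. 98 (2001), Lemma 4.4(1) [corpus:paper:doi-10-4064-aa98-3-4 p.7], here `g = 1`, `K = ℚ₂`;
equivalently `#W(ℚ₂)/2W(ℚ₂) = 2·#W(ℚ₂)[2]` from the finite-index `ℤ₂` in `W(ℚ₂)`, Silverman AEC VII.6.3): for every
`W : y² = x³ + a₂x² + a₄x + a₆` over `ℚ₂` whose cubic `c_W` is irreducible over `ℚ₂` (so `W(ℚ₂)[2] = 0`), the group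
`W(ℚ₂)/2W(ℚ₂)` has order EXACTLY 2: there is a point `P₀ ∉ 2W(ℚ₂)` such that every point is `≡ O` or `≡ P₀ (mod 2W(ℚ₂))`.
With HK₂/HK₂″/the congruence criterion over `ℚ₂` this says: the local condition at 2 on a class `u` is the single parity
`[u ∈ {1, κ₂(P₀)}]` — the «± object at 2» of the descent lens is one bit.
REF1 §94: SURVIVES as typed, OPEN-in-tree / in print, CLEARED; r4: `Irreducible (cubicK W)` also excludes singular `W` (an irreducible cubic in
characteristic `0` is separable) — without it the cusp `y² = x³` has `W(ℚ₂)` fully 2-divisible (REF1 eB2).  REF2 v25 §7: KNOWN IN PRINT = Stoll 2001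
Lemma 4.4 (1) (= Schaefer 1998 Prop. 2.4 = Milne ADT Lemma I.3.3) at `g = 1`, `K = ℚ₂`; open in the tree (no formal-group filtration of `E(ℚ₂)`
yet); beyond-print theorem: no.  [cite: Stoll2001, Lemma 4.4 (1)] [cite: Schaefer1998, Prop. 2.4] [cite: SilvermanAEC2009, Prop. VII.6.3] -/
def LocalImageOneBitAtTwo : Prop :=
  ∀ (W : WeierstrassCurve ℚ_[2]), W.a₁ = 0 → W.a₃ = 0 → Irreducible (cubicK W) →
    ∃ P₀ : W.toAffine.Point, (¬ ∃ R : W.toAffine.Point, R + R = P₀) ∧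
      ∀ P : W.toAffine.Point, (∃ R : W.toAffine.Point, R + R = P) ∨ (∃ R : W.toAffine.Point, R + R = P + P₀)

/-- Equivalent Kummer-side form of B2 (by `kummerCongruenceCriterionOver_holds` at `K = ℚ₂`): the local Kummer image at 2 has
exactly two square classes. -/
def LocalKummerImageOneBitAtTwo : Prop :=
  ∀ (W : WeierstrassCurve ℚ_[2]), W.a₁ = 0 → W.a₃ = 0 → Irreducible (cubicK W) →
    ∃ P₀ : W.toAffine.Point, ¬ IsSquare (kummerElt W P₀) ∧
      ∀ P : W.toAffine.Point, IsSquare (kummerElt W P) ∨ IsSquare (kummerElt W P * kummerElt W P₀)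

/-- The two forms of B2 are equivalent — a consequence of the kernel-proved congruence criterion over `ℚ₂`. -/
theorem localImageOneBitAtTwo_iff : LocalImageOneBitAtTwo ↔ LocalKummerImageOneBitAtTwo := by
  constructor
  · intro h W h1 h3 hirr
    obtain ⟨P₀, hP₀, hall⟩ := h W h1 h3 hirr
    have hc := kummerCongruenceCriterionOver_holds W h1 h3 hirr
    refine ⟨P₀, ?_, fun P => ?_⟩
    · intro hsq; apply hP₀
      have := (hc P₀ 0).mpr (by simpa using hsq)
      simpa using this
    · rcases hall P with ⟨R, hR⟩ | ⟨R, hR⟩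
      · left
        have := (hc P 0).mp ⟨R, by simpa using hR⟩
        simpa using this
      · right; exact (hc P P₀).mp ⟨R, hR⟩
  · intro h W h1 h3 hirr
    obtain ⟨P₀, hP₀, hall⟩ := h W h1 h3 hirr
    have hc := kummerCongruenceCriterionOver_holds W h1 h3 hirr
    refine ⟨P₀, ?_, fun P => ?_⟩
    · rintro ⟨R, hR⟩; apply hP₀
      have := (hc P₀ 0).mp ⟨R, by simpa using hR⟩
      simpa using this
    · rcases hall P with hsq | hsq
      · left
        obtain ⟨R, hR⟩ := (hc P 0).mpr (by simpa using hsq)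
        exact ⟨R, by simpa using hR⟩
      · right; exact (hc P P₀).mpr hsq

end Summit.BirchSwinnertonDyer.Rank1Residual.F1Sign2.KummerField
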